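import Literature.Analysis.UnboundedOperators.SpectralGapProofs
import Literature.Analysis.UnboundedOperators.StrongContRepresentationProofs
import Literature.Analysis.UnboundedOperators.FourierSpectrumGapProofs
import Literature.MathematicalPhysics.QuantumFieldTheory.MassGap
import HarnessLib

/-!
# Stone's theorem, bridge form, and uniqueness of the vacuum — proofs layer over `MassGap.lean`

This file discharges two named facts of `MassGap.lean`.

**1. `Literature.Analysis.UnboundedOperators.UnitaryRep.isGenerator_appReal_hamiltonian`:** for a strongly continuous one-parameter unitary group `U` on a complex Hilbert
space, the Hamiltonian `U.hamiltonian = -i A` of the prelude (`A` the generator of the forward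
semigroup `(U(t))_{t ≥ 0}`, right-hand difference quotients `t ↓ 0`, Engel–Nagel Ch. II
Def. 1.2) is a generator of the curve `U.appReal : ℝ → H →L[ℂ] H` in the unbundled sense of wave 0
(`QuantumFieldTheory.IsGenerator`: `dom H` is exactly the set of `ψ` whose *two-sided* difference
quotient `t⁻¹ (U(t) ψ - ψ)` converges on `𝓝[≠] 0`, and the limit is `i H ψ`).

This is the remark of Engel–Nagel (2000), §II.3.11 (*Generators of groups*: the generator of a
strongly continuous group, defined through two-sided limits, coincides — with equal domain —
with the generator of its forward semigroup `T₊`; also Pazy (1983), §1.6 after Def. 6.2, and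
Reed–Simon I, Thm. VIII.7 for the unitary case), whose two halves are the prelude facts
`OneParameterGroup.mem_generator_domain_iff_two_sided` (domains agree) and
`OneParameterGroup.tendsto_generator_two_sided` (limits agree), both discharged in
`Literature.Analysis.UnboundedOperators.StrongContRepresentationProofs`. The proof here is
the bookkeeping between the two encodings: `(t : ℂ)⁻¹ = ((t⁻¹ : ℝ) : ℂ)` (`Complex.ofReal_inv`),
`U.appReal t = OneParameterGroup.app U t` (`rfl`), `dom H = dom A` (`hamiltonian_domain`) and
`i • (-i) • A ψ = A ψ`.

**2. `Literature.Analysis.UnboundedOperators.UnitaryRep.HasMassGap.hasUniqueVacuum`:** under a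
mass gap `U.HasMassGap Ω Δ` (`Ω` a vacuum vector and `U.hamiltonian.HasGroundStateGap Ω Δ`) the
vacuum is unique, `U.HasUniqueVacuum Ω`, i.e. `U.invariantVectors = ℂ ∙ Ω`. In Streater–Wightman
(1964), §3-1, this is part of axiom 0 (eq. (3-1): the invariant state `Ψ₀` is "unique up to a
constant phase factor (uniqueness of the vacuum)"; cf. §1-3, "there is a unique state, the
vacuum, with `p = 0`"); in the bundled encoding it is a consequence of the definition, whose form
gap on `dom H ∩ {Ω}ᗮ` encodes that `0` is a simple eigenvalue of `H`. Proof: invariant vectors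
are exactly the zero-energy vectors, `U.invariantVectors = ker H`
(`UnitaryRep.invariantVectors_eq_kernel_hamiltonian`; Reed–Simon I, Thm. VIII.7 (c)), and
`ker H = ℂ ∙ Ω` under the form gap (`LinearPMap.HasFormGap.kernel_eq_span_holds` of
`Literature.Analysis.UnboundedOperators.SpectralGapProofs`; Reed–Simon IV, §XIII.12). This
restores the interim proof preserved as a comment in `MassGap.lean`, now fed discharged facts.

Sources: K.-J. Engel, R. Nagel, *One-Parameter Semigroups for Linear Evolution Equations*
(Springer GTM 194, 2000), §II.3.11; M. Reed, B. Simon, *Methods of Modern Mathematical Physics I*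
(Academic Press, 1980), Thm. VIII.7; R. F. Streater, A. S. Wightman, *PCT, Spin and Statistics,
and All That* (Benjamin, 1964; Princeton, 2000), §3-1, eq. (3-1).
-/

noncomputable section

open Filter Topology

namespace Literature.MathematicalPhysics.QuantumFieldTheory

open Literature.Analysis.UnboundedOperators
open Literature.Analysis.UnboundedOperators.UnitaryRep

variable {H : Type*} [NormedAddCommGroup H] [InnerProductSpace ℂ H] [CompleteSpace H]

/-- **Discharge of `UnitaryRep.isGenerator_appReal_hamiltonian`** (Stone's theorem, bridge form;
Engel–Nagel (2000), §II.3.11, *Generators of groups*: the generator of a strongly continuous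
group — two-sided difference quotients — is the generator of its forward semigroup, with the
same domain; Reed–Simon I, Thm. VIII.7). The domain half is
`OneParameterGroup.mem_generator_domain_iff_two_sided_holds`, the limit half is
`OneParameterGroup.tendsto_generator_two_sided_holds`, transported along
`(t : ℂ)⁻¹ = ((t⁻¹ : ℝ) : ℂ)`, `U.appReal t = OneParameterGroup.app U t` and
`i • (-i) • A ψ = A ψ` for `H = -i A`. [cite: EngelNagel2000, §II.3.11] -/
theorem _root_.Literature.Analysis.UnboundedOperators.UnitaryRep.isGenerator_appReal_hamiltonian_holds :
    isGenerator_appReal_hamiltonian (H := H) := by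
  intro U
  have key : ∀ ψ : H, (fun t : ℝ => ((t : ℂ)⁻¹) • (U.appReal t ψ - ψ)) =
      fun t : ℝ => ((t⁻¹ : ℝ) : ℂ) •
        (OneParameterGroup.app U.toStrongContRepresentation t ψ - ψ) := by
    intro ψ
    funext t
    rw [Complex.ofReal_inv, app_toStrongContRepresentation]
  refine ⟨fun ψ => ?_, fun ψ => ?_⟩
  · rw [hamiltonian_domain, key]
    exact OneParameterGroup.mem_generator_domain_iff_two_sided_holds U.toStrongContRepresentation ψ
  · have hI : Complex.I * -Complex.I = 1 := by rw [mul_neg, Complex.I_mul_I, neg_neg]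
    rw [key, hamiltonian_apply, smul_smul, hI, one_smul]
    exact OneParameterGroup.tendsto_generator_two_sided_holds U.toStrongContRepresentation ψ

/-- **Discharge of `UnitaryRep.HasMassGap.hasUniqueVacuum`** (uniqueness of the vacuum under a
mass gap): if `U.HasMassGap Ω Δ` then `Ω` is the unique vacuum of `U`,
`U.invariantVectors = ℂ ∙ Ω`. Streater–Wightman (1964), §3-1, axiom 0, eq. (3-1): the invariant
state is "unique up to a constant phase factor (uniqueness of the vacuum)"; here derived from the
bundled definition: `U.invariantVectors = ker H`
(`UnitaryRep.invariantVectors_eq_kernel_hamiltonian`, Reed–Simon I, Thm. VIII.7 (c)) and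
`ker H = ℂ ∙ Ω` under the form gap (`LinearPMap.HasFormGap.kernel_eq_span_holds`,
Reed–Simon IV, §XIII.12). [cite: StreaterWightman1964, §3-1 eq. (3-1)] -/
theorem _root_.Literature.Analysis.UnboundedOperators.UnitaryRep.HasMassGap.hasUniqueVacuum_holds :
    HasMassGap.hasUniqueVacuum (H := H) := by
  intro U Ω Δ h
  refine ⟨h.1, ?_⟩
  rw [invariantVectors_eq_kernel_hamiltonian]
  exact LinearPMap.HasFormGap.kernel_eq_span_holds h.2.hasFormGap

/-! ### Spectral form of the mass gap

Appended (literature-prover, 2026-08-15): discharge of the named fact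
`UnitaryRep.hasMassGap_iff_hasFourierSpectrumIn` of `MassGap.lean` — `U(t) = e^{itH}` has mass gap
`Δ` with vacuum `Ω` iff `Ω` is the unique vacuum, `0 < Δ`, and the Fourier spectrum of `U` lies in
`{0} ∪ [Δ, ∞)` (Streater–Wightman (1964), §3-1, spectral condition and uniqueness of the vacuum;
§2-6 for the smeared form `∫ ρ(a) U(a,1) da = ∫ ρ̃ dE` of "`S` is not in the spectrum"). It is
immediate from the prelude fact `UnitaryRep.hasGroundStateGap_hamiltonian_iff`, now proved in
`Literature.Analysis.UnboundedOperators.FourierSpectrumGapProofs`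
(`hasGroundStateGap_hamiltonian_iff_holds`, a spectral-theorem-free argument through the Schwartz
functional calculus `h ↦ ∫ 𝓕h(a) U(a) da`), exactly as in the interim proof preserved in
`MassGap.lean`. -/

/-- **Discharge of `UnitaryRep.hasMassGap_iff_hasFourierSpectrumIn`** (spectral form of the mass
gap; Streater–Wightman (1964), §3-1: the energy–momentum spectrum lies in `{0} ∪ {p² ≥ m²}` with
the vacuum the only normalisable state at `p = 0` — here in the one-parameter form
`σ ⊆ {0} ∪ [Δ, ∞)`). `U.HasMassGap Ω Δ` unfolds to `U.IsVacuum Ω ∧ U.hamiltonian.HasGroundStateGap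
Ω Δ`; the second conjunct is equivalent to the right-hand side by
`hasGroundStateGap_hamiltonian_iff_holds`, and the first is implied by `HasUniqueVacuum`.
[cite: StreaterWightman1964, §3-1] -/
theorem _root_.Literature.Analysis.UnboundedOperators.UnitaryRep.hasMassGap_iff_hasFourierSpectrumIn_holds :
    hasMassGap_iff_hasFourierSpectrumIn (H := H) := by
  intro U Ω Δ
  change U.IsVacuum Ω ∧ U.hamiltonian.HasGroundStateGap Ω Δ ↔ _
  rw [hasGroundStateGap_hamiltonian_iff_holds U Ω Δ]
  exact ⟨fun h => h.2, fun h => ⟨h.1.1, h⟩⟩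

end Literature.MathematicalPhysics.QuantumFieldTheory
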